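import Mathlib
import HarnessLib
import HarnessLib.Audit
import Summits.ValiantsHypothesis.Statement
import Summits.ValiantsHypothesis.ValiantsHypothesis.Theorems.DivisionGapPerNotVPToVH
import Summits.ValiantsHypothesis.ValiantsHypothesis.Theorems.BinomialElusiveRazTransferCircuit
import Summits.ValiantsHypothesis.ValiantsHypothesis.Theorems.BinomialElusiveRazTransferWitness
import Literature.Computability.AlgebraicComplexity.RazElusiveGeneralDischarge
import HarnessLib.Audit.Status.Attr

/-!
Route: BinomialElusive

DORMANT since 2026-08-27T20:20:39Z (director-valiant g8 ruling val-width INBOX l.36 (3), AMENDED l.50 (19:58:18Z); executed by tenure sweep g3 (lines-1 not yet seated): crux 7391 PeelingLemma = UNDECIDED (odds ≈ 0.6 false) — kernel nega) — unstaffed, not closed; items shared with open routes are served there. `ledger route dormant <id> --off` reactivates.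

# Route BinomialElusive — binomial B_h curves for Raz's (m-1,2) question — sparse non-monomial
candidates plus a peeling lemma

It suffices to show X = BinomialCandidate (card siegel-kills-monomial-elusive-curves, its KEPT
binomial half; the negative half,
Theorem N, is girth-vs-sidon-elusive C2 and is not re-filed): for all large m the explicit binomial
curve f_m : ℂ → ℂ^m,
f_{m,i}(x) = x^{E(2i+1)} + x^{E(2i+2)}, E(j) = Σ_{k ≤ h} (j·M)^k with h = ⌊log₂ m⌋², M =
(2m+2)^{h+1} (a carry-free power-sum
set: the 2m exponents admit no integer relation of length ≤ h; degree 2^{O((log m)^5)} =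
2^{m^{o(1)}}), is (m−1, 2)-elusive:
no polynomial map Γ : ℂ^{m−1} → ℂ^m of degree ≤ 2 has image containing f_m(ℂ). This is Raz's
abstract question with the
first candidates outside the monomial (toric) class, which is provably dead below height 2^{m−1}/m²
at s = m−1. By Raz 2010
(§1 result 1 via the multilinearisation of Prop. 1.2 — PROVED in the tree: `Raz2010_result_1_holds`,
`Raz2010_elusive_curve_holds`
in Literature/…/RazElusiveGeneralDischarge.lean; the instantiation for this family is PROVED as
`RazTransfer_proof` and inlined in `closes`) X gives per ∉ VP_ℂ, hence VP_ℂ ≠ VNP_ℂ.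
Lean: `∃ m₀ : ℕ, ∀ m ≥ m₀, ∀ Γ : Fin m → MvPolynomial (Fin (m - 1)) ℂ, (∀ i, (Γ i).totalDegree ≤ 2)
→ ¬ (Set.range (fun x : ℂ => fun i : Fin m => x ^ (∑ k ∈ Finset.range (Nat.log 2 m ^ 2 + 1), ((2 *
(i : ℕ) + 1) * (2 * m + 2) ^ (Nat.log 2 m ^ 2 + 1)) ^ k) + x ^ (∑ k ∈ Finset.range (Nat.log 2 m ^ 2
+ 1), ((2 * (i : ℕ) + 2) * (2 * m + 2) ^ (Nat.log 2 m ^ 2 + 1)) ^ k)) ⊆ Set.range (fun y : Fin (m -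
1) → ℂ => fun i : Fin m => MvPolynomial.eval y (Γ i)))`

## Assembly
Deciding theorem (rev 5, route-repair g3 2026-08-16; CRUX-ONLY per the human ruling of 2026-08-16;
native authority OK, axioms
{propext, Classical.choice, Quot.sound}): `closes (hX : BinomialCandidate) :
_root_.ValiantsHypothesis` — the thesis crux X is the ONLY
hypothesis; the two bridges are proved lemmas USED inside the proof, not assumed:
`PerNotVPToVH_holds` (per ∉ VP_ℂ → VP_ℂ ≠ VNP_ℂ,
gate-linked from Theorems/DivisionGapPerNotVPToVH.lean) and the content of support item RazTransfer
(X → per ∉ VP_ℂ), PROVED as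
`Summit.ValiantsHypothesis.ValiantsHypothesis.Theorems.RazTransfer_proof` (p106151, accepted
2026-08-16) — whose module imports this
route file, so the gate cannot link `RazTransfer_holds`; its ~150-line packaging of Raz 2010
(re-indexing m(n) = 2^{⌊log₂ n⌋²} with
m ≥ n^{ω(1)}, degree < 2ⁿ eventually, the Set.range ↔ IsElusive conversion, poly(n)-definability
(Def. 1.3) of the multilinearised
family by Valiant's criterion for mappings + the exponent-bit circuit, then
`Raz2010_elusive_curve.not_isVPFamily_complex
(Raz2010_elusive_curve_holds ℂ)`) is therefore INLINED in `closes` as `have`s, verbatim from that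
accepted file, over the cycle-free
modules Theorems/BinomialElusiveRazTransferCircuit.lean (expo, mFn, curve, expBits, expSize,
cktSize_lowBits_expo) and
Theorems/BinomialElusiveRazTransferWitness.lean (selMonomial, isPolyDefinableMap_of_cktSize) plus
Literature
RazElusiveGeneralDischarge, which the route now imports. The Assembly item (rev 3,
stmt-ValiantsHypothesis-16827, `BinomialCandidate →
ValiantsHypothesis`) is literally the type of `closes`; the gate does not allow dropping an assembly
item, so it stays and is
PROVABLE NOW in one line from the route file itself: `theorem binomialElusive_assembly :
…Theses.BinomialElusive.Assembly := fun hX =>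
…Theses.BinomialElusive.closes hX` (any prover; rev 2's tautological form stmt-10469 and rev 0's
stmt-7398 were retired earlier; the
orphan Theorems/BinomialElusiveAssembly.lean, written for the rev-2 shape, no longer elaborates —
re-point it to that one line or delete it). All mathematics of the line lives in PeelingLemma /
BinomialCandidate / BinomialMapsElusive; every support
(ToricBinomialElusive, NoShortRelations, NumericToPuiseux, RazTransfer, PerNotVPToVH) is proved in
the tree.

Rationale: WHY THIS LINE. At s = m−1 every monomial curve of height < 2^{m−1}/m² is swallowed by a monomial
quadratic map built from ONE long balanced
relation ⟨μ,d⟩ = 0 realised by cycle potentials (Theorem N of the card = girth-vs-sidon-elusive C2;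
the in-tree
Summit.ValiantsHypothesis.Elusive.not_elusive_candidate is its T = 3 instance; Narayanan2026 Rem. 1
is the doubling instance),
so "Im f ⊆ Im Γ" is a lattice condition and Raz's whole explicit range is toric-dead; with two
monomials per coordinate the same
single-monomial cycles need Π_P(1+x^{c_i}) = Π_N(1+x^{c_j}), impossible for distinct gaps
(ToricBinomialElusive: binomial
curves elude ALL monomial maps from < m variables, any degree), and every cheap non-toric swallower
we could write (graph maps,
ruled maps with unit corrections, two-monomial coordinates on monomial substitutions) needs m+1
relations among the 2m exponents,
one of length O(log m) by girth — which a B_h design forbids. The bet (PeelingLemma) is that this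
persists for all quadratic Γ:
a Laurent–Puiseux solution Γ(p(t)) = f(t^N) at the place over 0 (GargMakamOliveiraWigderson2019
Lemma 9.3 / Thm 1.21 made
quantitative; here via places of a dominating curve, NumericToPuiseux) peels, valuation by
valuation, into ≤ m quadrics on
leading coefficients, and two valuation events per coordinate against (m−1)·(jumps of p) freedoms
force a SHORT additive
configuration. Imported: additive combinatorics (carry-free power-sum B_h sets, short relations),
valuation/Newton–Puiseux
bookkeeping on algebraic curves, multiplicative independence of cyclotomic binomials; algebraic
complexity enters only through
Raz2010 (result 1, Prop. 1.2, Def. 1.3 — result 1 is PROVED in the tree, `Raz2010_result_1_holds` /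
`Raz2010_elusive_curve_holds`). Versus route Elusive (legacy, under floor; its Sidon monomial crux
refuted) and
Narayanan2026 (monomial curves, s = m^{9/10}, exponential degree, Chebotarev hitting sets):
non-monomial sparse candidates at
s = m−1 and quasi-polynomial degree, with a stated structural lemma whose refutation would itself be
new negative knowledge
("sparse curves die at s = m−1"). Negatives index: empty at filing; ElusiveCandidate (awaiting close
as refuted) is a
monomial curve and is not restated.

RANKED CRUXES. (Ranks after route-repair rev 2: 3 < 4 < 5, rank 3 = hardest / most informative; the
former #2 RazCurve was Raz's theorem, now proved in Literature and dropped.) #3 PeelingLemma (crux)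
— symbolic peeling at the place over 0 (card crux PeelingLemma, made concrete): for all large m, all
exponent data a, b : Fin m → ℕ, every quadratic Γ : ℂ^{m−1} → ℂ^m and every Laurent-series solution
p ∈ ℂ((t))^{m−1} of Γ(p(t)) = (t^{N a_i} + t^{N b_i})_i (N ≥ 1), the 2m exponents satisfy a nonzero
integer relation Σ_i (u_i a_i + v_i b_i) = 0 of length Σ(|u_i|+|v_i|) ≤ ⌊log₂ m⌋². (All known
swallowers give length ≤ 4 — equal coordinates, equal gaps, E ∩ (E+E) ≠ ∅, ruled coincidences — or
O(log m) — two-monomial coordinates on monomial substitutions, by girth of a multigraph with 2m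
edges on m−1 vertices; degenerate data (a_i = b_i, repeated exponents, exponent 0) produce relations
of length ≤ 2 automatically.) [difficulty: open-problem] (why it might fail: Theorem N swallows
monomial curves with ONE relation of length up to m; if unit cancellations (z_u z_v = x^a(1+x^c) −
E, z_u' z_v' = E) let a binomial swallower also live on one LONG relation (pigeonhole gives length
~(log m)^4 at our heights), the bound (log₂ m)² is false and so, likely, is X.) [arXiv:1904.04299,
Raz2010, Narayanan2026, BondySimonovits1974]
#4 BinomialCandidate (crux) — the thesis X (card crux BinomialElusive with the triage's carry-free
power-sum exponents): for all large m, no quadratic Γ : ℂ^{m−1} → ℂ^m has image containing the curve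
x ↦ (x^{E(2i+1)} + x^{E(2i+2)})_{i<m}, E(j) = Σ_{k≤h}(j(2m+2)^{h+1})^k, h = ⌊log₂ m⌋². Follows from
PeelingLemma + NumericToPuiseux + NoShortRelations by instantiation; may also be attacked directly
(everywhere-containment is stronger than the symbolic hypothesis: one uncovered point suffices,
Raz2010 p.137). [deps: PeelingLemma] [difficulty: open-problem] (why it might fail: A generic
quadratic image is a hypersurface of degree 2^{m−1} and the curve has degree 2^{(log m)^5} ≪
2^{m^{0.8}}, below every counting certificate (Narayanan2026 §1.3); a swallowing family for k-nomial
curves at s = m−1 (k+1 cancellation classes per ruled block, say) would kill X and the card.)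
[Raz2010, Narayanan2026, arXiv:1904.04299, KumarVolk2022]
#5 BinomialMapsElusive (crux) — the first non-toric rung: X restricted to quadratic maps Γ each of
whose coordinates has at most TWO monomials (binomial maps). Toric maps (one monomial) are settled
for every binomial curve with distinct gaps at every degree (ToricBinomialElusive); with two
monomials per coordinate the substitution z(x) may carry unit factors and cancellations, and
incidence of the moving m-plane L^{-1}(f(x)) ⊂ ℂ^{2m} with the toric image of z ↦ (z^{μ_i},
z^{ν_i})_i must be excluded for ALL x (expected dimension −1). [difficulty: L] (why it might fail:
Two-monomial coordinates z_u z_v + z_u' z_v' with non-monomial z(x) realise x^a(1+x^c) as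
(x^a(1+x^c) − E(x)) + E(x) for ANY E: the lattice rigidity of the toric case is gone, and a long
pigeonhole relation among the a_i plus free correction terms E might suffice.) [arXiv:1904.04299,
Narayanan2026, Raz2010]
#9 ToricBinomialElusive (support) — binomial curves with pairwise distinct positive gaps elude every
MONOMIAL map from fewer than m variables, of any degree: if s < m, c : Fin m → ℕ is injective with
c_i > 0, and each Γ_i ∈ ℂ[z_1..z_s] has at most one monomial, then the curve x ↦ (x^{a_i} +
x^{a_i+c_i})_i is not contained in Γ(ℂ^s). Proof: an integer left-kernel vector λ ≠ 0 of the m × s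
exponent matrix gives, on the cofinite set where all f_i(x) ≠ 0, Π f_i^{λ_i} = const, a polynomial
identity; cancel x-powers and constants, then the least gap on the positive side must equal the
least gap on the negative side (1 + x^c multiplicatively independent: top cyclotomic index 2c). The
card's dichotomy in theorem form: for binomials the toric sub-question carries no information.
PROVED (`toricBinomialElusive_proof`, Theorems/BinomialElusiveToricBinomialElusive.lean).
[difficulty: M, done] [arXiv:1904.04299, Narayanan2026]
#9 NoShortRelations (support) — the carry-free power-sum exponents have no short relations: for all
m, h and w : Fin (2m) → ℤ with Σ|w_j| ≤ h, Σ_j w_j E(j+1) = 0 forces w = 0, where E(j) = Σ_{k≤h}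
(j(2m+2)^{h+1})^k. Proof: base-M digits of Σ w_j E(j+1) are d_k = Σ_j w_j (j+1)^k with |d_k| ≤
h(2m)^h < M = (2m+2)^{h+1} (Bernoulli), so balanced base-M uniqueness gives d_k = 0 for k ≤ h; supp
w has ≤ h elements and the Vandermonde minor on it is invertible. With h = ⌊log₂ m⌋² this is exactly
what PeelingLemma's conclusion contradicts (w(2i) = u_i, w(2i+1) = v_i). PROVED
(`noShortRelations_proof`, Theorems/BinomialElusiveNoShortRelations.lean). [difficulty: M, done]
[Raz2010, BondySimonovits1974]
#9 NumericToPuiseux (support) — numeric-to-symbolic glue for curves (known; places of algebraic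
function fields / Newton–Puiseux, no GMOW transfer needed): if the binomial curve x ↦ (x^{a_i} +
x^{b_i})_i is contained in Γ(ℂ^s) then some irreducible curve C ⊆ {(x,y) : Γ(y) = f(x)} dominates
the x-line, and expanding the coordinates of C at a place over x = 0 (local parameter t with x =
t^N; poles allowed, hence LAURENT series) gives p ∈ ℂ((t))^s with Γ(p) = (t^{N a_i} + t^{N b_i})_i.
Glue: PeelingLemma ∧ NumericToPuiseux ∧ NoShortRelations → BinomialCandidate by instantiation.
PROVED (`Summit.ValiantsHypothesis.Theorems.numericToPuiseux_proof`,
Theorems/BinomialElusiveNumericToPuiseux.lean, via Literature NewtonPuiseuxProofs). [difficulty: L,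
done] [Stichtenoth2009, Hartshorne1977, arXiv:1904.04299, Artin1969]
#9 RazTransfer (support) — the bridge X → per ∉ VP_ℂ, i.e. BinomialCandidate → ¬IsVPFamily_ℂ(per_n),
stated over IsVPFamily / perPoly only so that the route file imports nothing beyond the Statement;
it replaces RazCurve + RazBridge of rev 0–1 (Raz 2010 §1 result 1 and the abstract's curve form are
PROVED in Literature: `Raz2010_result_1_holds`, `Raz2010_elusive_curve_holds`,
RazElusiveGeneralDischarge.lean, axioms {propext, Classical.choice, Quot.sound} checked 2026-08-15).
PROVED 2026-08-16: `RazTransfer_proof` (p106151;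
Theorems/BinomialElusiveRazTransfer{,Circuit,Witness}.lean), content inlined in `closes` (rev 5).
Plan as executed: re-index by n with m(n) = 2^{⌊log₂ n⌋²} (m ≥ n^{ω(1)}; h = ⌊log₂ m⌋² = ⌊log₂ n⌋⁴,
every exponent E(j) < 2^{O((log₂ n)^{10})} < 2ⁿ eventually, m(n) ≥ m₀ eventually); view f_{m,i} =
X_0^{E(2i+1)} + X_0^{E(2i+2)} ∈ MvPolynomial (Fin 1) ℂ and turn X's Set.range non-containment into
`IsElusive (f n) (m n - 1) 2` (polyMapEval over Fin 1 → ℂ has the same range; cf.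
Theorems/ElusiveRefutations not_isElusive_momentCurve); prove `IsPolyDefinableMap` (Def. 1.3) of
`fun n i => multilinearize n (f n i)`: the coefficient of x^S in f̂_{n,i} is [S = bits E(2i+1)] + [S
= bits E(2i+2)], the bits of E(2i+1), E(2i+2) come from the bits of i by poly(n)-size Boolean
circuits (school arithmetic on (log₂ n)^{10}-bit numbers), arithmetised by the transcript method the
tree used for Raz Prop. 5.5 (RazElusiveGeneralDefinable.lean: validPoly, boolSum; Raz2010 remark
after Def. 1.3 = Valiant's criterion, Burgisser2000 Prop. 2.20); then `Raz2010_elusive_curve_holds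
ℂ` (ringChar ℂ = 0 ≠ 2) gives ¬IsPComputable and IsVPFamily = IsPFamily ∧ IsPComputable the item
(pattern: `Raz2010_elusive_curve.not_isVPFamily_complex`). [difficulty: XL, done] [Raz2010,
Burgisser2000, Valiant1979]
#9 PerNotVPToVH (support) — hub glue shared with route DivisionGap (stmt-ValiantsHypothesis-5073,
same signature): ¬IsVPFamily_ℂ(per_n) → ValiantsHypothesis, three lines from
Summit.ValiantsHypothesis.Hub.valiantsHypothesis_of_not_isVPFamily_per, mem_VP_ofFintype_iff_holds
and perFamily_mem_VNP_holds ℂ; PROVED (`Summit.ValiantsHypothesis.Theorems.perNotVPToVH_proof`,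
linked as `PerNotVPToVH_holds`, used in `closes`). [difficulty: done] [Valiant1979, Burgisser2000]

TWO-LAYER PLAN. Foreseen glued splits, filed only when a crux moves: BinomialCandidate ⇐
PeelingLemma → NumericToPuiseux → NoShortRelations →
BinomialCandidate (instantiation glue, k = 3); PeelingLemma ⇐ HonestCase (no leading cancellation:
the valuation multigraph with 2m
edges on m−1 vertices has an even cycle / odd theta of length O(log m)) → CancellationCase (leading
cancellations force a relation
among potentials that re-enters the targets within ⌊log₂ m⌋² steps) → PeelingLemma;
BinomialMapsElusive ⇐ monomial-substitution
case (girth) → unit-correction case → BinomialMapsElusive.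

KILL CRITERIA. ¬PeelingLemma by an explicit swallowing MECHANISM for relation-free binomial curves
(a Γ + Laurent solution family living on one
long relation or on none) closes the route `refuted:PeelingLemma` if the mechanism covers the
power-sum family (then X is dead too)
— and its write-up "k-sparse curves are non-(m−1,2)-elusive below height H(k,m)" is the negative
theorem to land; ¬BinomialCandidate
alone (a swallower exploiting a specific feature of E(j), e.g. the common factor (2m+2)^{h+1} of all
gaps) ⇒ restate X once with a
repaired exponent family (tenure `--restate`), twice ⇒ close; ¬BinomialMapsElusive ⇒ PeelingLemma is
false at length (log₂ m)²:
pivot to s = ⌊m^{9/10}⌋ (Raz2010 result 1 needs only that; Narayanan2026 Rem. 2) or close. A theorem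
"every curve of degree
2^{m^{o(1)}} with poly(m) monomials in total is non-(m−1,2)-elusive" closes the route outright. X
proved elsewhere (any explicit
(m^{0.9},2)-elusive family of degree 2^{m^{o(1)}}, e.g. via the girth-vs-sidon line) moots it.

NOT DECOMPOSED YET. The s = ⌊m^{9/10}⌋ fallback of X (weaker, still sufficient for Raz result 1) — a
tenure restate, not an item now; the honest /
cancellative split of PeelingLemma (layer 2); the place at ∞ (valuations −N b_i) and mixed places;
trinomial and k-nomial
families (k = 3 with shifted powers (x+i)^D or Chebyshev coordinates) as the next rung if binomials
die; the girth lemma for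
multigraphs with 2m edges on m−1 vertices with heavy subdivision (needed inside PeelingLemma's
honest case, provers attach it with
--supports); the map version (monomial MAPS ℂ^n → ℂ^m) of everything; the explicit poly(n)-size
circuits of RazTransfer.

CHEAPEST FALSIFIER. Truncated-Laurent ansatz search against PeelingLemma at small m (kit, exact
linear algebra over ℚ): m = 5,6, random binomial
exponent data a, b ≤ 60 with no relation of length ≤ 4, Γ ranging over the structured families that
beat monomial curves (ruled
t·u_i + two free quadrics; one even cycle of two-monomial coordinates + pendant tree; graph maps)
and p_j = Σ_{e=−D}^{D} c_{j,e} t^e,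
D ≤ 3·max b: solve Γ(p) = f(t) coefficientwise. One solution without a short relation kills
PeelingLemma as stated. Not run here
(plancard seat, no kit); the triage's 15-minute structural attempts (ruled, monomial-Γ cycles, graph
swallowers) all FAILED to
swallow B_3/B_2-protected binomials, which is the evidence the line starts from.

NUMBERS. Monomial curves at s = m−1: dead below height 2^{m−1}/m² (Theorem N / girth C2; in-tree
instance not_elusive_candidate, m ≥ 7),
alive at height (m·2^m)^{m} by counting (C(m+ℓ,m) > C(m−1+2ℓ,m−1) needs ℓ > m·2^{m−1}); GMOW Prop
9.8: x ↦ (x^{3^i}) elusive vs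
monomial maps only. Narayanan2026 Thm 1: (z^{2^i})_{i<m} is (⌊m^{9/10}⌋,2)-elusive vs all quadratic
maps, degree 2^{m−1}; Rem 2:
degree 2^{m^{o(1)}} would give VP ≠ VNP. This route's family: 2m exponents, height 2^{O((log₂
m)^5)}, no relation of length
≤ ⌊log₂ m⌋², pigeonhole relations from length ≈ (log m)^4 on; Raz needs degree ≤ 2^{m^{o(1)}} and s
≥ m^{0.9} (we ask s = m−1).
Items at open: 10 (4 cruxes, 5 support, 1 assembly); after route-repair rev 2: 9 (3 cruxes, 5
support, 1 assembly); after route-repair g3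
(rev 5–6, 2026-08-16): 9 (3 cruxes open — PeelingLemma, BinomialCandidate, BinomialMapsElusive; 5
supports, all proved; 1 assembly = the type of `closes`,
provable now as `fun hX => closes hX`) + the crux-only deciding theorem `closes : BinomialCandidate
→ ValiantsHypothesis` (sorry-free,
standard axioms).

DEFINITION REQUESTS. None. IsElusive, IsPolyDefinableMap, multilinearize, IsPComputable, perPoly,
IsVPFamily exist
(Literature.Computability.AlgebraicComplexity.*); Laurent series are Mathlib's `LaurentSeries ℂ =
HahnSeries ℤ ℂ`. The exponent
family is inlined (no notion). A map-version of Valiant's criterion (IsRazExplicit-style coefficient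
computability ⇒
IsPolyDefinableMap) now EXISTS: `isPolyDefinableMap_of_cktSize`
(Theorems/BinomialElusiveRazTransferWitness.lean, p102160; Bürgisser 2000 Prop. 2.20 for
mappings) — reusable by the sibling girth line.

SUPPORT. Route-repair g3 (2026-08-16, glue.non-crux-hypothesis + cone guardrail): GLUE — the
deciding theorem is now crux-only,
`closes (hX : BinomialCandidate) : ValiantsHypothesis`, with both proved bridges used inside the
term (see ## Assembly); the route's
`imports` gained the cycle-free Theorems/BinomialElusiveRazTransferCircuit,
Theorems/BinomialElusiveRazTransferWitness and Literature
RazElusiveGeneralDischarge (none imports a Theses file). CONE — needs-fact: NONE.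
`PerNotPComputableComplex` / `VPNeVNPComplex`
(ValiantConjecture.lean) ARE the summit statement (registered-open @[conjecture] decls;
VPNeVNPComplex is definitionally
ValiantsHypothesis, PerNotPComputableComplex its standard equivalent,
`perNotPComputableComplex_iff_holds`), enter only through the
operator's Statement.lean import of ValiantConjecture.lean, and are used by no item and by nothing
in `closes`; the deprecated
`raz_elusive_curve` (misstated, ≡ PerNotPComputableComplex by
raz_elusive_curve_iff_perNotPComputableComplex, never to be proved) is
declared in RazElusiveGeneral.lean — the very file that states Raz's PROVED theorem
`Raz2010_elusive_curve` — so it lies in the import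
closure of EVERY Raz-based glue (routes GirthSidon and Elusive as well) while being used by nothing.
Neither is route debt: the gate's
constant-level cone (`#h21_route_deps`) lists 0 unproved deps (staffable YES); an import-closure
census that still flags them should
whitelist registered-open summit-equivalent decls — operator action, no prover should be seated on
them. History: rev 2 (2026-08-15)
dropped RazCurve/RazBridge and the RazElusiveGeneral import; rev 3 restated Assembly; rev 5
crux-only glue; rev 6 refreshes this text (the Assembly item cannot be dropped by
the gate's rule; it is the type of `closes` and provable now from it).

Novelty: Searches (2026-08-15): `lit frontier ValiantsHypothesis --since 2022` (30 rows; none on elusive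
maps); `lit bridges ValiantsHypothesis
--cross any` (30 rows; textbooks/surveys only); `lit galaxy search "elusive functions" --star all`
(40 rows, only Raz2010 relevant),
`"elusive polynomial mapping" --star pdf` (1: Raz2010), `"-elusive" --star pdf` (40, noise); `lit
search --source crossref "elusive
functions Raz sparse polynomial curves"` (10: Raz STOC 2008 + unrelated sparse-approximation book);
`lit search` local/arxiv/openalex/s2:
searchd rc 75 and HTTP 429 throughout (owed: keyword sweep "elusive functions binomial/sparse
curve"); `lit read doi:10.4086/toc.2010.v006a007`
pp.1–3 and `lit read arxiv:2607.15848` pp.1–5,7–9 read in full; tree: Theses/Elusive.lean,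
Theorems/ElusiveRefutations.lean,
Literature RazElusiveGeneral.lean, NumericToSymbolicTransfer.lean, both elusive idea cards and their
triage/audit notes.
Nearest prior art found: Raz2010 (abstract: the (m−1,2) curve question; §1 result 1);
GargMakamOliveiraWigderson2019 arXiv:1904.04299
§9 (Lemma 9.3 symbolic criterion, Prop 9.8 monomial-vs-monomial at degree 3^m, "negative exponents"
remark); Narayanan2026
arXiv:2607.15848 (Thm 1, Rem 1–2, Thm 2: monomial curves/maps, sumset expansion + Chebotarev,
exponential degree, s = m^{9/10});
in-tree not_elusive_candidate; hub cards girth-vs-sidon-elusive (monomial B_h at s = m^{0.9}; owns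
Theorem N) and the retired
elusive-digit card.
Delta: the first candidates for Raz's (m  [refs: 10.4086/toc.2010.v006a007`, 2607.15848, 1904.04299, doi:10.4086/toc.2010.v006a007, arxiv:2607.15848, Raz2010, GargMakamOliveiraWigderson2019, Narayanan2026]

Barriers (technique_class: elusive-functions, additive-combinatorics, valuations): - technique_class: elusive-functions, additive-combinatorics, valuations
- Literature.Barriers.ValiantsHypothesis.AlgebraicNaturalProofs: CONDITIONAL (FSV18 Thm 4/Cor 5 on
SuccinctHittingSetsForVP). An (m−1,2)-elusiveness certificate is non-vanishing of the implicit
equation H_Γ (degree up to 2^{m−1}) on the curve — not a poly-size, poly-degree VP-constructible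
distinguisher, so Thm 4 does not formally apply; conceded: the peeling method is closure-insensitive
(it certifies f ⊄ closure Im Γ), so it does not evade by the border/non-border gap either; the bet,
as for route Elusive and both cards, is that certifying ONE explicit sparse point set outside every
quadratic hypersurface image by additive number theory is not "natural" in FSV's sense — not known
to evade, not known to be blocked.
- Literature.Barriers.ValiantsHypothesis.RankMethods: not engaged — no sub-additive rank measure
appears; Raz's OTHER programme (tensor rank ⇒ formulas) is the one EGOW18 blocks.
- Literature.Barriers.ValiantsHypothesis.RankLifting: not engaged; GMOW2019 Thm 1.21 / Props 3.3–3.4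
(NumericToSymbolicTransfer.lean) are a TOOL here, and for curves even replaceable by places of
function fields (NumericToPuiseux).
- Literature.Barriers.ValiantsHypothesis.PermanentCharTwo: respected, not evaded — the route is
permanent-based but uses the characteristic: Raz's theorem carries `ringChar ≠ 2` and is applied
over ℂ (ringChar ℂ = 0); elusiveness itself is characteristic-free; consistent.
- Negatives index

History (route lifecycle, newest last):
- 2026-08-15T16:16:33Z · rev 2: restated Assembly (stmt-ValiantsHypothesis-7398) — route-repair rev 2 (2026-08-15): glue closes : BinomialCandidate → RazTransfer → PerNotVPToVH → ValiantsHypothesis + reroute: drop RazCurve/RazBridge (Raz resul (planner-rbadge-ValiantsHypothesis-BinomialElus-118b3564-g2-0)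
- 2026-08-15T16:16:33Z · rev 2: dropped RazCurve, RazBridge — route-repair rev 2 (2026-08-15): glue closes : BinomialCandidate → RazTransfer → PerNotVPToVH → ValiantsHypothesis + reroute: drop RazCurve/RazBridge (Raz resul (planner-rbadge-ValiantsHypothesis-BinomialElus-118b3564-g2-0)
- 2026-08-16T21:09:57Z · rev 3: restated Assembly (stmt-ValiantsHypothesis-10469 proved) — route-repair (ground-failed), 2026-08-16: payload.ground's ONLY flag is Assembly (stmt-ValiantsHypothesis-10469) = ground.trivial (tauto) — rev-2 Assembly := Bi (planner-rground-ValiantsHypothesis-BinomialElus-118b3564-0)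
- 2026-08-27T20:20:39Z · DORMANT — director-valiant g8 ruling val-width INBOX l.36 (3), AMENDED l.50 (19:58:18Z); executed by tenure sweep g3 (lines-1 not yet seated): crux 7391 PeelingLemma = UN (operator:999:825334)

sub-problem: ValiantsHypothesis · status: dormant · opened planner-plancard-ValiantsHypothesis-ValiantsH-61e57672-0 2026-08-15T12:08:48Z · rev 6 · ledger route-ValiantsHypothesis-BinomialElusive
GENERATED by the gate from the ledger (D-0016/17). Provers cite these decls: `theorem foo : Summit.ValiantsHypothesis.ValiantsHypothesis.Theses.BinomialElusive.<Decl> := …` in Summits/ValiantsHypothesis/ValiantsHypothesis/Theorems/<Name>.lean.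
-/

namespace Summit.ValiantsHypothesis.ValiantsHypothesis.Theses.BinomialElusive

open scoped BigOperators Topology Manifold Classical MeasureTheory ProbabilityTheory Matrix InnerProductSpace ComplexConjugate ContinuousMap
open Filter Set Function TopologicalSpace MeasureTheory

attribute [summit_statement] _root_.ValiantsHypothesis

open Literature.PNP

/-- item stmt-ValiantsHypothesis-7391 · crux · rank 3 · open · by planner
why it might fail: Theorem N swallows monomial curves with ONE relation of length up to m; if unit cancellations (z_u z_v = x^a(1+x^c) − E, z_u' z_v' = E) let a binomial swallower also live on one LONG relation (pigeonhole gives length ~(log m)^4 at our heights), the bound (log₂ m)² is false and so, likely, is X.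
sources: arXiv:1904.04299, Raz2010, Narayanan2026, BondySimonovits1974
[crux] symbolic peeling at the place over 0 (card crux PeelingLemma, made concrete): for all large
m, all exponent data a, b : Fin m → ℕ, every quadratic Γ : ℂ^{m−1} → ℂ^m and every Laurent-series
solution p ∈ ℂ((t))^{m−1} of Γ(p(t)) = (t^{N a_i} + t^{N b_i})_i (N ≥ 1), the 2m exponents satisfy a
nonzero integer relation Σ_i (u_i a_i + v_i b_i) = 0 of length Σ(|u_i|+|v_i|) ≤ ⌊log₂ m⌋². (All
known swallowers give length ≤ 4 — equal coordinates, equal gaps, E ∩ (E+E) ≠ ∅, ruled coincidences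
— or O(log m) — two-monomial coordinates on monomial substitutions, by girth of a multigraph with 2m
edges on m−1 vertices; degenerate data (a_i = b_i, repeated exponents, exponent 0) produce relations
of length ≤ 2 automatically.) [difficulty: open-problem] -/
@[route_item "route-ValiantsHypothesis-BinomialElusive", crux]
def PeelingLemma : Prop :=
  ∃ m₀ : ℕ, ∀ m ≥ m₀, ∀ (a b : Fin m → ℕ) (Γ : Fin m → MvPolynomial (Fin (m - 1)) ℂ) (N : ℕ) (p : Fin (m - 1) → LaurentSeries ℂ), (∀ i, (Γ i).totalDegree ≤ 2) → 0 < N → (∀ i, MvPolynomial.aeval p (Γ i) = HahnSeries.single ((N * a i : ℕ) : ℤ) (1 : ℂ) + HahnSeries.single ((N * b i : ℕ) : ℤ) (1 : ℂ)) → ∃ u v : Fin m → ℤ, (u, v) ≠ 0 ∧ ∑ i, (|u i| + |v i|) ≤ ((Nat.log 2 m ^ 2 : ℕ) : ℤ) ∧ ∑ i, (u i * (a i : ℤ) + v i * (b i : ℤ)) = 0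

/-- item stmt-ValiantsHypothesis-7392 · crux · rank 4 · open · by planner
why it might fail: A generic quadratic image is a hypersurface of degree 2^{m−1} and the curve has degree 2^{(log m)^5} ≪ 2^{m^{0.8}}, below every counting certificate (Narayanan2026 §1.3); a swallowing family for k-nomial curves at s = m−1 (k+1 cancellation classes per ruled block, say) would kill X and the card.
sources: Raz2010, Narayanan2026, arXiv:1904.04299, KumarVolk2022
[crux] the thesis X (card crux BinomialElusive with the triage's carry-free power-sum exponents):
for all large m, no quadratic Γ : ℂ^{m−1} → ℂ^m has image containing the curve x ↦ (x^{E(2i+1)} +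
x^{E(2i+2)})_{i<m}, E(j) = Σ_{k≤h}(j(2m+2)^{h+1})^k, h = ⌊log₂ m⌋². Follows from PeelingLemma +
NumericToPuiseux + NoShortRelations by instantiation; may also be attacked directly
(everywhere-containment is stronger than the symbolic hypothesis: one uncovered point suffices,
Raz2010 p.137). [deps: PeelingLemma] [difficulty: open-problem] -/
@[route_item "route-ValiantsHypothesis-BinomialElusive", crux]
def BinomialCandidate : Prop :=
  ∃ m₀ : ℕ, ∀ m ≥ m₀, ∀ Γ : Fin m → MvPolynomial (Fin (m - 1)) ℂ, (∀ i, (Γ i).totalDegree ≤ 2) → ¬ (Set.range (fun x : ℂ => fun i : Fin m => x ^ (∑ k ∈ Finset.range (Nat.log 2 m ^ 2 + 1), ((2 * (i : ℕ) + 1) * (2 * m + 2) ^ (Nat.log 2 m ^ 2 + 1)) ^ k) + x ^ (∑ k ∈ Finset.range (Nat.log 2 m ^ 2 + 1), ((2 * (i : ℕ) + 2) * (2 * m + 2) ^ (Nat.log 2 m ^ 2 + 1)) ^ k)) ⊆ Set.range (fun y : Fin (m - 1) → ℂ => fun i : Fin m => MvPolynomial.eval y (Γ i)))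

/-- item stmt-ValiantsHypothesis-7393 · crux · rank 5 · open · by planner
why it might fail: Two-monomial coordinates z_u z_v + z_u' z_v' with non-monomial z(x) realise x^a(1+x^c) as (x^a(1+x^c) − E(x)) + E(x) for ANY E: the lattice rigidity of the toric case is gone, and a long pigeonhole relation among the a_i plus free correction terms E might suffice.
sources: arXiv:1904.04299, Narayanan2026, Raz2010
[crux] the first non-toric rung: X restricted to quadratic maps Γ each of whose coordinates has at
most TWO monomials (binomial maps). Toric maps (one monomial) are settled for every binomial curve
with distinct gaps at every degree (ToricBinomialElusive); with two monomials per coordinate the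
substitution z(x) may carry unit factors and cancellations, and incidence of the moving m-plane
L^{-1}(f(x)) ⊂ ℂ^{2m} with the toric image of z ↦ (z^{μ_i}, z^{ν_i})_i must be excluded for ALL x
(expected dimension −1). [difficulty: L] -/
@[route_item "route-ValiantsHypothesis-BinomialElusive"]
def BinomialMapsElusive : Prop :=
  ∃ m₀ : ℕ, ∀ m ≥ m₀, ∀ Γ : Fin m → MvPolynomial (Fin (m - 1)) ℂ, (∀ i, (Γ i).totalDegree ≤ 2) → (∀ i, (Γ i).support.card ≤ 2) → ¬ (Set.range (fun x : ℂ => fun i : Fin m => x ^ (∑ k ∈ Finset.range (Nat.log 2 m ^ 2 + 1), ((2 * (i : ℕ) + 1) * (2 * m + 2) ^ (Nat.log 2 m ^ 2 + 1)) ^ k) + x ^ (∑ k ∈ Finset.range (Nat.log 2 m ^ 2 + 1), ((2 * (i : ℕ) + 2) * (2 * m + 2) ^ (Nat.log 2 m ^ 2 + 1)) ^ k)) ⊆ Set.range (fun y : Fin (m - 1) → ℂ => fun i : Fin m => MvPolynomial.eval y (Γ i)))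

/-- item stmt-ValiantsHypothesis-5073 · support · rank 9 · closed · proved by Summit.ValiantsHypothesis.Theorems.perNotVPToVH_proof @ dff3b3fa0027 (prover) · by planner
sources: Valiant1979, Burgisser2000
[support] bookkeeping glue, PROVED in the planner's Sketch.lean from proved cone facts: ¬
IsVPFamily_ℂ (per_n) → ValiantsHypothesis, by
Summit.ValiantsHypothesis.Hub.valiantsHypothesis_of_not_isVPFamily_per (Theorems/HubHub.lean) with
mem_VP_ofFintype_iff_holds and perFamily_mem_VNP_holds ℂ. Three lines. [difficulty: provable-now] -/
@[route_item "route-ValiantsHypothesis-BinomialElusive"]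
def PerNotVPToVH : Prop :=
  ¬ Literature.Computability.AlgebraicComplexity.IsVPFamily (k := ℂ) (fun n => Literature.Computability.AlgebraicComplexity.perPoly (Fin n) ℂ) → ValiantsHypothesis

/-- `PerNotVPToVH` holds: proved by `Summit.ValiantsHypothesis.Theorems.perNotVPToVH_proof` @ dff3b3fa0027. -/
theorem PerNotVPToVH_holds : PerNotVPToVH := _root_.Summit.ValiantsHypothesis.Theorems.perNotVPToVH_proof

/-- item stmt-ValiantsHypothesis-7394 · support · rank 9 · closed · proved by Summit.ValiantsHypothesis.ValiantsHypothesis.Theorems.BinomialElusiveToricBinomialElusive.toricBinomialElusive_proof @ 33a4dd82addd (prover) · by planner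
sources: arXiv:1904.04299, Narayanan2026
[support] binomial curves with pairwise distinct positive gaps elude every MONOMIAL map from fewer
than m variables, of any degree: if s < m, c : Fin m → ℕ is injective with c_i > 0, and each Γ_i ∈
ℂ[z_1..z_s] has at most one monomial, then the curve x ↦ (x^{a_i} + x^{a_i+c_i})_i is not contained
in Γ(ℂ^s). Proof: an integer left-kernel vector λ ≠ 0 of the m × s exponent matrix gives, on the
cofinite set where all f_i(x) ≠ 0, Π f_i^{λ_i} = const, a polynomial identity; cancel x-powers and
constants, then the least gap on the positive side must equal the least gap on the negative side (1
+ x^c multiplicatively independent: top cyclotomic index 2c). The card's dichotomy in theorem form: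
for binomials the toric sub-question carries no information. [difficulty: M] -/
@[route_item "route-ValiantsHypothesis-BinomialElusive"]
def ToricBinomialElusive : Prop :=
  ∀ (m s : ℕ), s < m → ∀ (a c : Fin m → ℕ), (∀ i, 0 < c i) → Function.Injective c → ∀ Γ : Fin m → MvPolynomial (Fin s) ℂ, (∀ i, (Γ i).support.card ≤ 1) → ¬ (Set.range (fun x : ℂ => fun i : Fin m => x ^ a i + x ^ (a i + c i)) ⊆ Set.range (fun y : Fin s → ℂ => fun i : Fin m => MvPolynomial.eval y (Γ i)))

-- `ToricBinomialElusive` holds: proved by `Summit.ValiantsHypothesis.ValiantsHypothesis.Theorems.BinomialElusiveToricBinomialElusive.toricBinomialElusive_proof` @ 33a4dd82addd (its module imports this route file, so no `_holds` link can be stated here).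

/-- item stmt-ValiantsHypothesis-7395 · support · rank 9 · closed · proved by Summit.ValiantsHypothesis.ValiantsHypothesis.Theorems.BinomialElusiveNoShortRelations.noShortRelations_proof @ 2360025b4fa7 (prover) · by planner
sources: Raz2010, BondySimonovits1974
[support] the carry-free power-sum exponents have no short relations: for all m, h and w : Fin (2m)
→ ℤ with Σ|w_j| ≤ h, Σ_j w_j E(j+1) = 0 forces w = 0, where E(j) = Σ_{k≤h} (j(2m+2)^{h+1})^k. Proof:
base-M digits of Σ w_j E(j+1) are d_k = Σ_j w_j (j+1)^k with |d_k| ≤ h(2m)^h < M = (2m+2)^{h+1}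
(Bernoulli), so balanced base-M uniqueness gives d_k = 0 for k ≤ h; supp w has ≤ h elements and the
Vandermonde minor on it is invertible. With h = ⌊log₂ m⌋² this is exactly what PeelingLemma's
conclusion contradicts (w(2i) = u_i, w(2i+1) = v_i). [difficulty: M] -/
@[route_item "route-ValiantsHypothesis-BinomialElusive"]
def NoShortRelations : Prop :=
  ∀ (m h : ℕ) (w : Fin (2 * m) → ℤ), ∑ j, |w j| ≤ (h : ℤ) → ∑ j, w j * ((∑ k ∈ Finset.range (h + 1), (((j : ℕ) + 1) * (2 * m + 2) ^ (h + 1)) ^ k : ℕ) : ℤ) = 0 → w = 0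

-- `NoShortRelations` holds: proved by `Summit.ValiantsHypothesis.ValiantsHypothesis.Theorems.BinomialElusiveNoShortRelations.noShortRelations_proof` @ 2360025b4fa7 (its module imports this route file, so no `_holds` link can be stated here).

/-- item stmt-ValiantsHypothesis-7396 · support · rank 9 · closed · proved by Summit.ValiantsHypothesis.Theorems.numericToPuiseux_proof (prover) · by planner
sources: Stichtenoth2009, Hartshorne1977, arXiv:1904.04299, Artin1969
[support] numeric-to-symbolic glue for curves (known; places of algebraic function fields /
Newton–Puiseux, no GMOW transfer needed): if the binomial curve x ↦ (x^{a_i} + x^{b_i})_i is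
contained in Γ(ℂ^s) then some irreducible curve C ⊆ {(x,y) : Γ(y) = f(x)} dominates the x-line, and
expanding the coordinates of C at a place over x = 0 (local parameter t with x = t^N; poles allowed,
hence LAURENT series) gives p ∈ ℂ((t))^s with Γ(p) = (t^{N a_i} + t^{N b_i})_i. Glue: PeelingLemma ∧
NumericToPuiseux ∧ NoShortRelations → BinomialCandidate by instantiation. Mathlib lacks
Puiseux/places of curves: real but classical formalisation work. [difficulty: L] -/
@[route_item "route-ValiantsHypothesis-BinomialElusive"]
def NumericToPuiseux : Prop :=
  ∀ (m s : ℕ) (a b : Fin m → ℕ) (Γ : Fin m → MvPolynomial (Fin s) ℂ), 0 < m → Set.range (fun x : ℂ => fun i : Fin m => x ^ a i + x ^ b i) ⊆ Set.range (fun y : Fin s → ℂ => fun i : Fin m => MvPolynomial.eval y (Γ i)) → ∃ (N : ℕ) (p : Fin s → LaurentSeries ℂ), 0 < N ∧ ∀ i, MvPolynomial.aeval p (Γ i) = HahnSeries.single ((N * a i : ℕ) : ℤ) (1 : ℂ) + HahnSeries.single ((N * b i : ℕ) : ℤ) (1 : ℂ)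

-- `NumericToPuiseux` holds: proved by `Summit.ValiantsHypothesis.Theorems.numericToPuiseux_proof` (its module imports this route file, so no `_holds` link can be stated here).

/-- item stmt-ValiantsHypothesis-8497 · support · rank 9 · closed · proved by Summit.ValiantsHypothesis.ValiantsHypothesis.Theorems.RazTransfer_proof (prover) · by planner
[support] (route-repair rev 1; replaces the retired crux RazCurve and the support RazBridge) the
bridge from X to per ∉ VP_ℂ: BinomialCandidate → ¬IsVPFamily_ℂ(per_n), stated over IsVPFamily /
perPoly only so that the route file needs no import beyond the Statement (Raz's vocabulary lives in
the PROOF). Proof plan — known mathematics, formalisation debt: (1) re-index by n with m(n) =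
2^{⌊log₂ n⌋²} (m ≥ n^{ω(1)}; every exponent E(j) < 2^{O((log m)^5)} = 2^{O((log n)^10)} < 2ⁿ
eventually); (2) view f_{m,i} = X_0^{E(2i+1)} + X_0^{E(2i+2)} ∈ ℂ[X_0] (MvPolynomial (Fin 1) ℂ) and
turn X's Set.range-non-containment into `IsElusive (f n) (m n - 1) 2` (polyMapEval; cf.
Theorems/ElusiveRefutations not_isElusive_momentCurve); (3) Raz-explicitness, Def. 1.3:
`IsPolyDefinableMap` of the multilinearised family `multilinearize n (f n i)` — the coefficient of
x^S in f̂_{n,i} is [S = bits(E(2i+1))] + [S = bits(E(2i+2))], computed from the bits of i by a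
poly(n)-size Boolean circuit (school arithmetic on (log n)^{10}-bit numbers) and arithmetised by the
tree's transcript method exactly as Raz's Prop. 5.5 was (RazElusiveGeneralDefinable.lean:
CircuitArithmetization validPoly, DefinableVNP boolSum; Bur -/
@[route_item "route-ValiantsHypothesis-BinomialElusive"]
def RazTransfer : Prop :=
  (∃ m₀ : ℕ, ∀ m ≥ m₀, ∀ Γ : Fin m → MvPolynomial (Fin (m - 1)) ℂ, (∀ i, (Γ i).totalDegree ≤ 2) → ¬ (Set.range (fun x : ℂ => fun i : Fin m => x ^ (∑ k ∈ Finset.range (Nat.log 2 m ^ 2 + 1), ((2 * (i : ℕ) + 1) * (2 * m + 2) ^ (Nat.log 2 m ^ 2 + 1)) ^ k) + x ^ (∑ k ∈ Finset.range (Nat.log 2 m ^ 2 + 1), ((2 * (i : ℕ) + 2) * (2 * m + 2) ^ (Nat.log 2 m ^ 2 + 1)) ^ k)) ⊆ Set.range (fun y : Fin (m - 1) → ℂ => fun i : Fin m => MvPolynomial.eval y (Γ i)))) → ¬ Literature.Computability.AlgebraicComplexity.IsVPFamily (k := ℂ) (fun n => Literature.Computability.AlgebraicComplexity.perPoly (Fin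 n) ℂ)

-- `RazTransfer` holds: proved by `Summit.ValiantsHypothesis.ValiantsHypothesis.Theorems.RazTransfer_proof` (its module imports this route file, so no `_holds` link can be stated here).

-- earlier Assembly (stmt-ValiantsHypothesis-10469, replaced 2026-08-16T21:09:57Z -> stmt-ValiantsHypothesis-16827): proved by Summit.ValiantsHypothesis.Theorems.binomialElusive_assembly_proof @ f77b79f0dbc0 — BinomialCandidate → RazTransfer → PerNotVPToVH → ValiantsHypothesis
-- earlier Assembly (stmt-ValiantsHypothesis-7398, replaced 2026-08-15T16:16:33Z -> stmt-ValiantsHypothesis-10469): retired by None — RazCurve → BinomialCandidate → RazBridge → PerNotVPToVH → ValiantsHypothesis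
/-- item stmt-ValiantsHypothesis-16827 · assembly · rank 1 · closed · proved by Summit.ValiantsHypothesis.Theorems.binomialElusive_assembly_proof @ e924c929a29f (prover) · by planner
sources: Raz2010, Valiant1979, Burgisser2000
[assembly] BinomialCandidate → ValiantsHypothesis: the thesis X ALONE yields the sub-problem
Statement `_root_.ValiantsHypothesis` — the content of the two bridge items RazTransfer (X → per ∉
VP_ℂ; Raz 2010 §1 result 1 for the explicit binomial family, PROVED in tree:
Theorems/BinomialElusiveRazTransfer.lean `RazTransfer_proof`, p106151) and PerNotVPToVH (per ∉ VP_ℂ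
→ VH, proved), so it closes by `fun hX => PerNotVPToVH_holds
(Summit.ValiantsHypothesis.ValiantsHypothesis.Theorems.RazTransfer_proof hX)` in a Theorems file
importing both (checked sorry-free, standard axioms, in the planner's Sketch.lean). Restated
2026-08-16 by route-repair (ground-failed): rev 2 had Assembly := BinomialCandidate → RazTransfer →
PerNotVPToVH → ValiantsHypothesis, the propositional tautology ((X → A) → (A → VH) → X → VH with
both bridges itemised) flagged ground.trivial (tauto); that legacy form stays proved as
stmt-ValiantsHypothesis-10469 in Theorems/BinomialElusiveAssembly.lean
(binomialElusive_assembly_proof), which `unfold`s the replaced constant and no longer elaborates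
against this render — operator: retire that 30-line file or re-point it to the two-line proof above.
The deciding theorem is un -/
@[route_item "route-ValiantsHypothesis-BinomialElusive"]
def Assembly : Prop :=
  BinomialCandidate → ValiantsHypothesis

-- `Assembly` holds: proved by `Summit.ValiantsHypothesis.Theorems.binomialElusive_assembly_proof` @ e924c929a29f (its module imports this route file, so no `_holds` link can be stated here).

/-! D-0027 §2.1 — DECIDING THEOREM (planner-authored via `route open/edit --closes-file`; by planner-rbadge-ValiantsHypothesis-BinomialElus-118b3564-g3-0 2026-08-16T21:34:59Z):
its hypotheses are this route's items and its conclusion the sub-problem Statement (glue_lint), and it elaborates with this file. -/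

@[closes "route-ValiantsHypothesis-BinomialElusive"] theorem closes (hX : BinomialCandidate) : _root_.ValiantsHypothesis := by
  -- CRUX-ONLY (ruling 2026-08-16): the sole hypothesis is the thesis crux X = `BinomialCandidate`.
  -- Both bridges are PROVED and USED, not assumed: `PerNotVPToVH_holds` (per ∉ VP_ℂ → VH, linked)
  -- and the content of support `RazTransfer` (X → per ∉ VP_ℂ; `RazTransfer_proof`, p106151, whose
  -- module imports this file, so no `_holds` link is possible): its packaging of Raz 2010 §1 result 1
  -- (`Raz2010_elusive_curve_holds ℂ`) is inlined below from that accepted file over the cycle-free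
  -- modules Thms/BinomialElusiveRazTransfer{Circuit,Witness} (`T.` := that namespace).
  refine PerNotVPToVH_holds ?_
  have log_mFn : ∀ n : ℕ, Nat.log 2 (Theorems.BinomialElusiveRazTransfer.mFn n) = Nat.log 2 n ^ 2 :=
    fun n => Nat.log_pow (by norm_num) _
  -- `m(n) = 2^{⌊log₂ n⌋²} ≥ n^{ω(1)}`
  have mFn_growth : ∀ c : ℕ, ∃ n₀ : ℕ, ∀ n ≥ n₀, n ^ c ≤ Theorems.BinomialElusiveRazTransfer.mFn n := by
    intro c
    refine ⟨2 ^ (c + 1), fun n hn => ?_⟩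
    have hL : c + 1 ≤ Nat.log 2 n := Nat.le_log_of_pow_le (by norm_num) hn
    have hn' : n < 2 ^ (Nat.log 2 n + 1) := Nat.lt_pow_succ_log_self (by norm_num) n
    calc n ^ c ≤ (2 ^ (Nat.log 2 n + 1)) ^ c := Nat.pow_le_pow_left hn'.le c
      _ = 2 ^ ((Nat.log 2 n + 1) * c) := by rw [← pow_mul]
      _ ≤ 2 ^ (Nat.log 2 n ^ 2) := Nat.pow_le_pow_right (by norm_num) (by nlinarith)
  refine Literature.Computability.AlgebraicComplexity.Raz2010_elusive_curve.not_isVPFamily_complex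
    (Literature.Computability.AlgebraicComplexity.Raz2010_elusive_curve_holds ℂ)
    (m := Theorems.BinomialElusiveRazTransfer.mFn) (f := Theorems.BinomialElusiveRazTransfer.curve)
    mFn_growth ?_ ?_ ?_
  · /- degree `< 2ⁿ` eventually: `E_m(j) < (2m+2)^{(h+2)(h+1)}`, `h = ⌊log₂ m⌋²`, and a
       polylogarithmic exponent is eventually below `n` -/
    have expo_lt : ∀ m j : ℕ, 1 ≤ j → j ≤ 2 * m → Theorems.BinomialElusiveRazTransfer.expo m j <
        (2 * m + 2) ^ ((Nat.log 2 m ^ 2 + 2) * (Nat.log 2 m ^ 2 + 1)) := by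
      intro m j hj1 hj
      set h := Nat.log 2 m ^ 2 with hh
      have hB : 2 ≤ (2 * m + 2) ^ (h + 1) :=
        le_trans (by omega) (Nat.le_self_pow (Nat.succ_ne_zero h) (2 * m + 2))
      have hy : 2 ≤ j * (2 * m + 2) ^ (h + 1) := le_trans hB (Nat.le_mul_of_pos_left _ hj1)
      unfold Theorems.BinomialElusiveRazTransfer.expo
      rw [← hh]
      calc ∑ k ∈ Finset.range (h + 1), (j * (2 * m + 2) ^ (h + 1)) ^ k
          < (j * (2 * m + 2) ^ (h + 1)) ^ (h + 1) :=
            Nat.geomSum_lt hy fun k hk => Finset.mem_range.1 hk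
        _ ≤ ((2 * m + 2) * (2 * m + 2) ^ (h + 1)) ^ (h + 1) := by
            gcongr
            omega
        _ = (2 * m + 2) ^ ((h + 2) * (h + 1)) := by rw [← pow_succ', pow_mul]
    obtain ⟨T, hT⟩ :=
      Literature.Computability.AlgebraicComplexity.eventually_mul_pow_lt_two_pow 10 18
    refine ⟨2 ^ max T 1, fun n hn i => ?_⟩
    have hn1 : 1 ≤ n := le_trans Nat.one_le_two_pow hn
    have hL : max T 1 ≤ Nat.log 2 n := Nat.le_log_of_pow_le (by norm_num) hn
    have hlogM := log_mFn n
    set M := Theorems.BinomialElusiveRazTransfer.mFn n with hM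
    set L := Nat.log 2 n with hLdef
    have hL1 : 1 ≤ L := le_trans (le_max_right _ _) hL
    have hlt : (L ^ 2 + 2) * ((L ^ 4 + 2) * (L ^ 4 + 1)) < n := by
      have h2 : L ^ 2 + 2 ≤ 3 * L ^ 2 := by nlinarith [Nat.one_le_pow 2 L hL1]
      have h4 : L ^ 4 + 2 ≤ 3 * L ^ 4 := by nlinarith [Nat.one_le_pow 4 L hL1]
      have h4' : L ^ 4 + 1 ≤ 2 * L ^ 4 := by nlinarith [Nat.one_le_pow 4 L hL1]
      calc (L ^ 2 + 2) * ((L ^ 4 + 2) * (L ^ 4 + 1)) ≤ (3 * L ^ 2) * ((3 * L ^ 4) * (2 * L ^ 4)) :=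
            Nat.mul_le_mul h2 (Nat.mul_le_mul h4 h4')
        _ = 18 * L ^ 10 := by ring
        _ < 2 ^ L := hT L (le_trans (le_max_left _ _) hL)
        _ ≤ n := by rw [hLdef]; exact Nat.pow_log_le_self 2 (by omega)
    have hMdef : M = 2 ^ (L ^ 2) := by
      rw [hM, hLdef]; unfold Theorems.BinomialElusiveRazTransfer.mFn; rfl
    have hB : 2 * M + 2 ≤ 2 ^ (L ^ 2 + 2) := by
      have : 1 ≤ 2 ^ (L ^ 2) := Nat.one_le_two_pow
      rw [hMdef]
      calc 2 * 2 ^ (L ^ 2) + 2 ≤ 2 * 2 ^ (L ^ 2) + 2 * 2 ^ (L ^ 2) := by omega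
        _ = 2 ^ (L ^ 2 + 2) := by ring
    have hE : ∀ j, 1 ≤ j → j ≤ 2 * M → Theorems.BinomialElusiveRazTransfer.expo M j < 2 ^ n := by
      intro j hj1 hj
      calc Theorems.BinomialElusiveRazTransfer.expo M j
          < (2 * M + 2) ^ ((Nat.log 2 M ^ 2 + 2) * (Nat.log 2 M ^ 2 + 1)) := expo_lt M j hj1 hj
        _ = (2 * M + 2) ^ ((L ^ 4 + 2) * (L ^ 4 + 1)) := by rw [hlogM, ← pow_mul]
        _ ≤ (2 ^ (L ^ 2 + 2)) ^ ((L ^ 4 + 2) * (L ^ 4 + 1)) := Nat.pow_le_pow_left hB _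
        _ = 2 ^ ((L ^ 2 + 2) * ((L ^ 4 + 2) * (L ^ 4 + 1))) := by rw [← pow_mul]
        _ < 2 ^ n := Nat.pow_lt_pow_right (by norm_num) hlt
    unfold Theorems.BinomialElusiveRazTransfer.curve
    refine (MvPolynomial.totalDegree_add _ _).trans_lt (max_lt ?_ ?_) <;>
      rw [MvPolynomial.totalDegree_X_pow] <;> exact hE _ (by omega) (by omega)
  · /- explicitness: the multilinearised curve is poly(`n`)-definable (Raz 2010 Def. 1.3) by
       Valiant's criterion for mappings and the exponent-bit circuit -/
    have ml_eq_sum : ∀ (n : ℕ) (p : MvPolynomial (Fin 1) ℂ) (S : Finset (Fin 1 →₀ ℕ)),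
        p.support ⊆ S → Literature.Computability.AlgebraicComplexity.multilinearize n p =
          ∑ d ∈ S, MvPolynomial.C (MvPolynomial.coeff d p) *
            Literature.Computability.AlgebraicComplexity.multilinMonomial n (d 0) := by
      intro n p S hS
      unfold Literature.Computability.AlgebraicComplexity.multilinearize
      refine Finset.sum_subset hS fun d _ hd => ?_
      rw [MvPolynomial.notMem_support_iff.1 hd, MvPolynomial.C_0, zero_mul]
    have ml_add : ∀ (n : ℕ) (p q : MvPolynomial (Fin 1) ℂ),
        Literature.Computability.AlgebraicComplexity.multilinearize n (p + q) =
          Literature.Computability.AlgebraicComplexity.multilinearize n p +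
            Literature.Computability.AlgebraicComplexity.multilinearize n q := by
      intro n p q
      rw [ml_eq_sum n (p + q) _ MvPolynomial.support_add,
        ml_eq_sum n p _ Finset.subset_union_left,
        ml_eq_sum n q _ Finset.subset_union_right, ← Finset.sum_add_distrib]
      refine Finset.sum_congr rfl fun d _ => ?_
      rw [MvPolynomial.coeff_add, MvPolynomial.C_add, add_mul]
    have ml_X_pow : ∀ n e : ℕ, Literature.Computability.AlgebraicComplexity.multilinearize n
        ((MvPolynomial.X 0 : MvPolynomial (Fin 1) ℂ) ^ e) =
          Theorems.BinomialElusiveRazTransfer.selMonomial n fun j => e.testBit j := by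
      intro n e
      unfold Literature.Computability.AlgebraicComplexity.multilinearize
      rw [MvPolynomial.X_pow_eq_monomial, MvPolynomial.support_monomial, if_neg one_ne_zero,
        Finset.sum_singleton, MvPolynomial.coeff_monomial, if_pos rfl, MvPolynomial.C_1, one_mul,
        Finsupp.single_eq_same]
      rfl
    have sum_fin_one_bool : ∀ (n : ℕ) (F : (Fin 1 → Bool) → MvPolynomial (Fin n) ℂ),
        ∑ c : Fin 1 → Bool, F c = F (fun _ => true) + F (fun _ => false) := by
      intro n F
      rw [← Fintype.sum_equiv (Equiv.funUnique (Fin 1) Bool).symm (fun b => F fun _ => b) F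
        (fun b => rfl), Fintype.sum_bool]
    have ofBits_index : ∀ (n : ℕ) (i : Fin (Theorems.BinomialElusiveRazTransfer.mFn n)),
        Nat.ofBits (fun w : Fin (Nat.clog 2 (Theorems.BinomialElusiveRazTransfer.mFn n)) =>
          (i : ℕ).testBit w) = i := by
      intro n i
      rw [Nat.ofBits_testBit, Nat.mod_eq_of_lt]
      exact i.isLt.trans_le (Nat.le_pow_clog one_lt_two _)
    have isPBounded_expSize : Literature.Computability.AlgebraicComplexity.IsPBounded fun n =>
        Theorems.BinomialElusiveRazTransfer.expSize (Theorems.BinomialElusiveRazTransfer.mFn n) n := by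
      have hid := Literature.Computability.AlgebraicComplexity.IsPBounded.id
      have hc := Literature.Computability.AlgebraicComplexity.IsPBounded.const
      have hadd := @Literature.Computability.AlgebraicComplexity.IsPBounded.add_holds
      have hmul := @Literature.Computability.AlgebraicComplexity.IsPBounded.mul_holds
      have hpow := @Literature.Computability.AlgebraicComplexity.IsPBounded.pow_holds
      have hb : Literature.Computability.AlgebraicComplexity.IsPBounded
          fun n => 2400 * (n ^ 4 + 1) * (n + 1) ^ 2 :=
        hmul (hmul (hc 2400) (hadd (hpow hid 4) (hc 1))) (hpow (hadd hid (hc 1)) 2)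
      refine hb.mono fun n => (Theorems.BinomialElusiveRazTransfer.expSize_le _ n).trans ?_
      rw [log_mFn, ← pow_mul]
      have hL : Nat.log 2 n ^ (2 * 2) ≤ n ^ 4 := Nat.pow_le_pow_left (Nat.log_le_self 2 n) 4
      gcongr
    refine Theorems.BinomialElusiveRazTransfer.isPolyDefinableMap_of_cktSize (k := ℂ)
      (t := fun _ => 1) Theorems.BinomialElusiveRazTransfer.expBits (fun _ => Nat.one_pos)
      (fun n => Theorems.BinomialElusiveRazTransfer.cktSize_lowBits_expo _ n _) isPBounded_expSize
      (Literature.Computability.AlgebraicComplexity.IsPBounded.const 1) _ fun n i => ?_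
    -- `f̂_{n,i} = Σ_{c ∈ {0,1}} x^{expBits n (bits i, c)}`
    rw [sum_fin_one_bool, Theorems.BinomialElusiveRazTransfer.curve, ml_add, ml_X_pow, ml_X_pow,
      add_comm]
    congr 2 <;> funext l <;>
      simp only [Theorems.BinomialElusiveRazTransfer.expBits,
        Theorems.BinomialElusiveRazTransfer.lowBits, Sum.elim_inl, Sum.elim_inr, ofBits_index,
        Bool.toNat_true, Bool.toNat_false, add_zero]
  · /- elusiveness: X in Raz's vocabulary (`Set.range ↔ IsElusive`; `m(n) ≥ m₀` eventually;
       `T.expo m j` unfolds to the exponent written out in `BinomialCandidate`) -/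
    have range_curve : ∀ n : ℕ,
        Set.range (Literature.Computability.AlgebraicComplexity.polyMapEval
            (Theorems.BinomialElusiveRazTransfer.curve n)) =
          Set.range (fun x : ℂ => fun i : Fin (Theorems.BinomialElusiveRazTransfer.mFn n) =>
            x ^ Theorems.BinomialElusiveRazTransfer.expo
                (Theorems.BinomialElusiveRazTransfer.mFn n) (2 * i + 1) +
              x ^ Theorems.BinomialElusiveRazTransfer.expo
                (Theorems.BinomialElusiveRazTransfer.mFn n) (2 * i + 2)) := by
      intro n
      ext v
      constructor
      · rintro ⟨y, rfl⟩
        exact ⟨y 0, funext fun i => by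
          simp [Literature.Computability.AlgebraicComplexity.polyMapEval,
            Theorems.BinomialElusiveRazTransfer.curve]⟩
      · rintro ⟨x, rfl⟩
        exact ⟨fun _ => x, funext fun i => by
          simp [Literature.Computability.AlgebraicComplexity.polyMapEval,
            Theorems.BinomialElusiveRazTransfer.curve]⟩
    have hX' := hX
    unfold BinomialCandidate at hX'
    obtain ⟨m₀, hm₀⟩ := hX'
    obtain ⟨n₁, hn₁⟩ := mFn_growth 1
    refine ⟨max n₁ m₀, fun n hn => ?_⟩
    have hmn : m₀ ≤ Theorems.BinomialElusiveRazTransfer.mFn n :=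
      (le_of_max_le_right hn).trans (by simpa using hn₁ n (le_of_max_le_left hn))
    intro Γ hΓ hsub
    refine hm₀ _ hmn Γ hΓ ?_
    rw [range_curve] at hsub
    exact hsub

end Summit.ValiantsHypothesis.ValiantsHypothesis.Theses.BinomialElusive
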